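import Summits.BirchSwinnertonDyer.BirchSwinnertonDyer.Theorems.GenusKolyvaginAtTwoGenusDeepSupplyAtTwoNegDiscNarrowDepthZeroAntiInvariantReading
import Literature.NumberTheory.EllipticCurves.GeomPointsEmbeddingDescent
import HarnessLib

/-!
# Route `GenusKolyvaginAtTwo`, crux `GenusDeepSupplyAtTwoNegDiscNarrow` (stmt-BirchSwinnertonDyer-23491): CLAIM B ON THE CURVE,
# `K`-RATIONAL FORM — an anti-invariant `Y ∈ E(K) ∖ 2E(K)` does not reduce to `Õ` at the ramified prime on the `#Sel₂(E) = 1` cell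

Width seat `bsd-line-gk2-p4` g25 (cell `bsd-f1-sign2`), `--supports stmt-BirchSwinnertonDyer-23491` (helper; closes nothing).
THEOREMS ONLY (no definition, no named fact, no `sorry`); **BSD is NOT proved by any of this; no item is closed.**

CONTEXT. Fifth file of Claim B of the LEAD's depth-zero reduction criterion. `…DepthZeroAntiInvariantReading` (p764523) proved
`red_𝔓(e_*Y) ≠ Õ` for an anti-invariant `Y ∈ E(K)` whose image in `E(ℚ̄)` has no half fixed by `res(Γ_K)` — the GEOMETRIC form of
`Y ∉ 2E(K)`. This file supplies the relative Galois descent `E(ℚ̄)^{res Γ_K} = e_*E(K)` (the tree's `GeomPointsEmbeddingDescent`, read for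
the embedding `e = absEmbedding ℚ K : K → ℚ̄`) and restates the theorem with the `K`-RATIONAL hypothesis `¬ ∃ Q ∈ E(K), 2Q = Y`:

* §1 `exists_map_absEmbedding_eq_of_forall_smul_eq` — a point of `E(ℚ̄)` fixed by every `σ ∈ Γ_ℚ` with `σ|_K = 1` is `e_*Q` for some
  `Q ∈ E(K)`; `no_rational_half_of_not_exists_two_smul` — hence `Y ∉ 2E(K)` gives the geometric hypothesis of p764523.
* §2 **`geomReduction_map_absEmbedding_ne_zero_of_anti_of_not_two_dvd`** — `W/ℚ` globally minimal, `Δ_W < 0`, `K` imaginary quadratic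
  with `d_K = −ℓ` (`ℓ` odd prime), Heegner, `#Sel₂(W) = 1`, `τ ≠ 1` in `Aut(K/ℚ)`, `Y ∈ E(K)` with `τY = −Y` and `Y ∉ 2E(K)`:
  **`red_𝔓(e_*Y) ≠ Õ`** at the tree's place over `ℓ`.

READING (LEAD memo §2, Claim B; R₁ of `DepthZero.nonCMAtTwo_of_items_of_reductionBits`): with `P₀ ↦ y_K`, `t = P₀ + τP₀ ∈ E(ℚ)_tors`
of odd order `m` (`E(ℚ)[2] = 0`), `s₀ = ((m+1)/2)t`, `Y = P₀ − s₀` is anti-invariant and `Y ∉ 2E(K) ⟺ P₀ ∉ 2E(K) ⟸ M₀ = 0` (K₁); so on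
the `#Sel₂(E) = 1` cell of the prime Heegner twin `K₁ ⟹ red_𝔓(e_*P₀) ≠ red_𝔓(e_*s₀)`, and since `2·red(e_*Y) = red(e_*(P₀ − τP₀)) = Õ`
(inertia) while `red(e_*(s₀ − s))` has odd order for Aut-fixed torsion `s`, `red_𝔓(e_*P₀) ∉ red_𝔓(e_*(E(K)^{Aut}_tors))` — the bit R₁.
That last bookkeeping step (Gross 5.3 + odd torsion, the LEAD's/g33's currency) is NOT in this file.

References: [SilvermanAEC2009] VIII §1 (proof of Prop. 1.2), X.5 Cor. 5.4; [GrossLMS1991] §5 Prop. 5.3, Prop. 4.7 (1);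
[MazurRubin2010] Prop. 3.3, Cor. 3.4 (i).
-/

set_option linter.dupNamespace false -- tree convention: `Summit.BirchSwinnertonDyer.BirchSwinnertonDyer.Theorems` (summit = sub-problem)
set_option autoImplicit false

noncomputable section

open scoped Classical Pointwise

namespace Summit.BirchSwinnertonDyer.BirchSwinnertonDyer.Theorems.GenusSupplyNarrow.DepthZero

open WeierstrassCurve Field NumberField IsDedekindDomain Function
open Literature.NumberTheory.EllipticCurves Literature.NumberTheory.GaloisRepresentations
open Literature.NumberTheory.GaloisCohomology

/-! ## §1 Relative Galois descent along `e = absEmbedding ℚ K` -/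

section Descent

variable (W : WeierstrassCurve ℚ) {K : Type} [Field K] [NumberField K]

/-- **`E(ℚ̄)^{res Γ_K} = e_*E(K)`**: a geometric point fixed by every `σ ∈ Γ_ℚ` restricting to the identity of `K` (`σ|_K = 1`,
i.e. `σ` fixes `e(K)` pointwise) is the image of a `K`-rational point under `e_* = Affine.Point.map (absEmbedding ℚ K)` — the tree's
`exists_embPoints_eq_of_forall_smul_eq` (coordinates in the closed intermediate field `e(K)`, infinite Galois theory) read for `e`.
[cite: SilvermanAEC2009, VIII.§1 (proof of Prop. 1.2)] [cite: GrossLMS1991, Prop. 4.7 (1)] -/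
theorem exists_map_absEmbedding_eq_of_forall_smul_eq [Normal ℚ K] (H : W.geomPoints)
    (hH : ∀ σ : absoluteGaloisGroup ℚ, absGaloisQuot ℚ K σ = 1 → σ • H = H) :
    ∃ Q : (W.baseChange K).toAffine.Point, Affine.Point.map (W' := W) (absEmbedding ℚ K) Q = H := by
  have hemb : ∀ k : ℚ, (absEmbedding ℚ K).toRingHom (algebraMap ℚ K k) = algebraMap ℚ (AlgebraicClosure ℚ) k :=
    fun k ↦ (absEmbedding ℚ K).commutes k
  obtain ⟨Q, hQ⟩ := exists_embPoints_eq_of_forall_smul_eq (K := ℚ) W (absEmbedding ℚ K).toRingHom hemb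
    (show (W.baseChange K).toAffine.Point →+ geomPoints (W.baseChange ℚ) from
      Affine.Point.map (W' := W) (absEmbedding ℚ K)) (fun _ ↦ rfl) H (fun g hg ↦ hH g <| by
        rw [absGaloisQuot_eq_one_iff, mem_range_absGaloisRestrict_iff_smul_absEmbedding]
        exact hg)
  exact ⟨Q, hQ⟩

/-- **`Y ∉ 2E(K)` ⟹ no half of `e_*Y` is fixed by `res(Γ_K)`** (the geometric hypothesis of
`geomReduction_map_absEmbedding_ne_zero_of_anti_of_selmerTrivial_prime`): a `res(Γ_K)`-fixed half `H` descends to `Q ∈ E(K)` with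
`e_*(2Q) = e_*Y`, `e_*` injective. [cite: SilvermanAEC2009, VIII.§1] -/
theorem no_rational_half_of_not_exists_two_smul [Normal ℚ K] {Y : (W.baseChange K).toAffine.Point}
    (hY : ¬ ∃ Q : (W.baseChange K).toAffine.Point, (2 : ℤ) • Q = Y) :
    ∀ H : W.geomPoints, (2 : ℤ) • H = Affine.Point.map (W' := W) (absEmbedding ℚ K) Y →
      ∃ σ : absoluteGaloisGroup ℚ, absGaloisQuot ℚ K σ = 1 ∧ σ • H ≠ H := by
  intro H h2
  by_contra hcon
  push Not at hcon
  obtain ⟨Q, hQ⟩ := exists_map_absEmbedding_eq_of_forall_smul_eq W H hcon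
  refine hY ⟨Q, Affine.Point.map_injective (W' := W) (absEmbedding ℚ K) ?_⟩
  rw [map_zsmul, hQ]
  exact h2

end Descent

/-! ## §2 Claim B on the curve, `K`-rational form -/

section Curve

variable (W : WeierstrassCurve ℚ) [W.IsElliptic] [W.IsGloballyMinimal]

/-- **CLAIM B ON THE CURVE, `K`-RATIONAL FORM.** `W/ℚ` globally minimal elliptic with `Δ_W < 0`, `K` imaginary quadratic with
`d_K = −ℓ` (`ℓ` an odd prime), Heegner for `N_W`, `#Sel₂(W) = 1`, `τ ≠ 1` in `Aut(K/ℚ)`, and `Y ∈ E(K)` ANTI-INVARIANT (`τY = −Y`)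
with **`Y ∉ 2E(K)`**. THEN **`red_𝔓(e_*Y) ≠ Õ`** at the tree's place over `ℓ` (`red_𝔓 = geomReduction`, `e = absEmbedding ℚ K`).
For the cell: `Y = P₀ − s₀` with `P₀ ↦ y_K` and `s₀` the torsion half of Gross 5.3, and `Y ∉ 2E(K) ⟸ M₀ = 0` (K₁), so this is
«K₁ ⟹ the reduction bit» on the `#Sel₂(E) = 1` cell of the prime Heegner twin, up to the odd-torsion bookkeeping of R₁.
[cite: MazurRubin2010, Prop. 3.3, Cor. 3.4 (i)] [cite: SilvermanAEC2009, X.5 Cor. 5.4, VIII §1–§2, VII.3.1] [cite: GrossLMS1991, §5 Prop. 5.3] -/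
theorem geomReduction_map_absEmbedding_ne_zero_of_anti_of_not_two_dvd
    {K : Type} [Field K] [NumberField K] (hΔneg : W.Δ < 0) (hK : IsImaginaryQuadratic K)
    (hH : SatisfiesHeegnerHypothesis (W.conductorNorm ℤ) K) {ℓ : ℕ} [Fact ℓ.Prime] (hℓ2 : ℓ ≠ 2) (hd : discr K = -(ℓ : ℤ))
    (h1 : Nat.card (W.selmerGroup 2) = 1) {τ : K ≃ₐ[ℚ] K} (hτ : τ ≠ 1)
    {Y : (W.baseChange K).toAffine.Point} (hanti : τ • Y = -Y)
    (hY : ¬ ∃ Q : (W.baseChange K).toAffine.Point, (2 : ℤ) • Q = Y)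
    (hΔ : ¬ (ℓ : ℤ) ∣ minimalDiscriminantInt W) :
    geomReduction hΔ (Affine.Point.map (W' := W) (absEmbedding ℚ K) Y : W.geomPoints) ≠ 0 := by
  haveI : Algebra.IsQuadraticExtension ℚ K := ⟨hK.1⟩
  haveI : IsGalois ℚ K := inferInstance
  exact geomReduction_map_absEmbedding_ne_zero_of_anti_of_selmerTrivial_prime W hΔneg hK hH hℓ2 hd h1 hτ hanti
    (no_rational_half_of_not_exists_two_smul W hY) hΔ

end Curve

end Summit.BirchSwinnertonDyer.BirchSwinnertonDyer.Theorems.GenusSupplyNarrow.DepthZero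

end
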